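import Literature.MathematicalPhysics.QuantumFieldTheory.Balaban1983to89.B8ScaledSupNorm

/-!
# `Balaban1983to89.B8Ineq197` — T. Bałaban, *Spaces of regular gauge field configurations on a lattice and gauge fixing
# conditions*, Commun. Math. Phys. **99** (1985) 75–102 [Balaban1985RegularSpaces], p. 92: the remainder estimate (1.97)
# «… < O(1)B₁(α₀ + α₁)α₄(Lʲη)⁻². Thus it is a function with a bounded norm |·|_(−2)» and the local half of (1.98)
# «|Vf|_(−2) ≤ O(α₄)|f|_(−2)», PROVED as the displayed implications on the multi-level norms of p. 86

statement-level skeleton of published theorems with citation tags; proofs where landed; nothing here is a claim about the Yang–Mills mass gap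

PDF held: `paper:balaban1985-cmp99-regular-spaces-gauge-fixing` (journal page = PDF page + 74); page read for this module AS IMAGE:
render `run/shared/lean/pub/pub-balaban/b2b-balaban-ref1/pages/1985-cmp99-regular-spaces-gauge-fixing/…-p018-x2.png` (p. 92,
(1.93)–(1.98)); p. 86 (the norms `|·|_(α)`) through the tree module `B8ScaledSupNorm`.

CITATION HEADER (lean-in-tree rule).  Cell `lit-balaban` (HOME `run/shared/lean/pub/lit-balaban/`), unit `lit-balaban-r05` gen 5
(reader/typer and fold owner of block B8).  WHAT IS REPRODUCED = the displays (1.97) and (1.98) of SKELETON row `B8.Eq1.99`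
((1.97)–(1.99) pp. 92–93; cell status «(1.97) untyped; (1.98)–(1.99) carried as hypotheses» — ref-3 g4 NOTE-c): (1.97) TYPED and
PROVED as the implication print states (inputs: the (1.89)-shape bound of the `𝔉₃`-term, the bound `|Dλ − DH′D′(u₁, λ)| < α₄(Lʲη)⁻¹`
of (1.120), the bound `|A_b| < B₁(α₀ + α₁)(Lʲη)⁻¹` of (1.69); output: the pointwise bound and «a bounded norm |·|_(−2)»), and the
`V`-half of (1.98) PROVED for every local operator with `‖V(x)‖ ≤ c`.  The `R`-half of (1.98), «|Rf|_(−2) ≤ B′₀|f|_(−2)» ("from Theorems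
3.1, 3.2 of [4]", asserted — GAPS G-B8-04 of the cell census), and (1.99) stay hypotheses of `B8SectDSource.ineq1101` (the repaired
reading in `B8Prop5Repaired`).  Kind «definition + kernel-checked proof» (one definition: the star `st(x)`); no `… : Prop` fact without
a body; no existing module is modified.

WHAT IS PRINTED (p. 92 [PDF 18], verbatim).  *"Now we will investigate properties of the function R𝔉₄. Let us denote by V the
operator g(…) − 1 in the internal bracket […] in (1.94). It is a very simple local operator of the form (Vf)(x) = V(x)f(x), where V(x)
is a linear operator on the Lie algebra 𝔤, satisfying the bound |V| ≦ O(α₄). … Let us consider the term with the function 𝔉₃ in Eq.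
(1.93). Using the inequality (1.89) we can bound a value of this function at a point x ∈ Ω_j by
O(1) max_{b∈st(x)} |(Dλ)(b) − (DH′D′(u₁, λ))(b)| |A_b| < O(1)α₄(Lʲη)⁻¹B₁(α₀ + α₁)(Lʲη)⁻¹ = O(1)B₁(α₀ + α₁)α₄(Lʲη)⁻². (1.97)
Thus it is a function with a bounded norm |·|_(−2).  The operators R and V are bounded in this norm, and we have
|Rf|_(−2) ≦ B′₀|f|_(−2), |Vf|_(−2) ≦ O(α₄)|f|_(−2). (1.98)"*  Inputs, verbatim: (1.89) p. 91 *"|g₃(λ(x), Dλ, A)| ≦ O(1)|Dλ||A|"*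
("g₃ depends on (Dλ)(b), A_b for b ∈ st(x)"); (1.120) p. 96 *"|λ − H′X| < α₄, |D(λ − H′X)| < α₄(Lʲη)⁻¹ on Ω_j"*; (1.69) p. 88
*"|A| < B₁(α₀ + α₁)(Lʲη)⁻¹ … on Ω_j, j = 0, 1, …, k − 1"*; p. 77: *"we denote by Ω also the set of bonds ⋃_{x∈Ω} st(x) = {bonds b ⊂ T_η:
at least one end-point of b belongs to Ω}"*.

WHAT THIS FILE PROVES (kernel, no `sorry`, standard axioms).  Carriers of `B8ScaledSupNorm`/`B8Ineq132`: sites `ℤᵈ`, bonds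
`⟨y, y + e_μ⟩ ↔ (y, μ)`, values in a seminormed group `E` (the Lie algebra `𝔤`), the domain sequence `Ω : ℕ → Set ℤᵈ` with "bond ∈
Ω_j" = `B8Ineq132.BondTouches`, the norms `siteNorm`/`bondNorm L k η α Ω` of p. 86 (`α = −2`, `−1`), block size `L`, spacing `η`.
* `InStar x y μ` — «`b ∈ st(x)`»: the bond `⟨y, y + e_μ⟩` has `x` as an end-point; `bondTouches_of_inStar` (p. 77: then `b ∈ Ω_j`
  whenever `x ∈ Ω_j`).
* **`ineq197_pointwise`** — (1.97) pointwise: if `‖F(x)‖ ≤ C·‖X_b‖·‖A_b‖` for some `b ∈ st(x)` (the (1.89) shape, `X = Dλ −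
  DH′D′(u₁, λ)`, `F` the `𝔉₃`-term), `‖X_b‖ < a(Lʲη)⁻¹` and `‖A_b‖ < s(Lʲη)⁻¹` for `b ∈ Ω_j`, then `‖F(x)‖ ≤ C·a·s·(Lʲη)⁻²` for
  `x ∈ Ω_j` (print: `a = α₄`, `s = B₁(α₀ + α₁)`, `C = O(1)`).
* **`ineq197_norm`** — «Thus it is a function with a bounded norm |·|_(−2)»: `|F|_(−2) ≤ C·a·s` (`siteNorm … (−2) Ω F`).
* **`siteNorm_le_of_pointwise_dom`** — a site function dominated pointwise, `‖G(x)‖ ≤ c‖F(x)‖`, has `|G|_(α) ≤ c|F|_(α)` for every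
  exponent `α` (bounded `F`); **`ineq198_local`** — (1.98), `V`-half: for a local operator `(Vf)(x) = V(x)f(x)` with `‖V(x)‖ ≤ c`
  (continuous linear `V(x)` on `E`), `|Vf|_(α) ≤ c|f|_(α)`, in particular for `α = −2` with `c = O(α₄)`.
HONEST SCOPE.  (i) «on Ω_j, j < k» / «j = 0, …, k − 1»: the statements quantify over `j ≤ k` for a free level count `k` (print's range is
the instance `k ↦ k − 1`).  (ii) Strict `<` inputs give `≤` outputs (sup-norm convention of `B8ScaledSupNorm`).  (iii) The concrete
`𝔉₃`/`g₃` of (1.88)–(1.89) (`B8Eq186AdCommutator`) and the concrete `D`, `H′`, `D′` are not instantiated here — (1.97) is proved as the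
implication between the displayed bounds, exactly as the sentence "Using the inequality (1.89) we can bound …" argues; the `R`-half of
(1.98) and (1.99) are NOT proved (B9 inputs, see above).
DECLARATIONS: 1 definition (`InStar`), the rest theorems; imports `B8ScaledSupNorm` only; REUSED BY NAME: `B8ScaledSupNorm.siteNorm,
msup, msup_le, msup_nonneg, Bdd, weight, weight_nonneg, weight_mul_norm_le_msup, siteNorm_le_of_pointwise, scale_pos`,
`B8Ineq132.BondTouches`, `B7Prop1Explicit.Site, e`.  Unit `lit-balaban-r05` (gen 5), 2026-08-21.

[cite: Balaban1985RegularSpaces, (1.97)–(1.98) p.92; (1.89) p.91; (1.120) p.96; (1.69) p.88; p.86 (definition after (1.55));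
p.77 (convention before (1.5))]
-/

noncomputable section

open NormedSpace

namespace Literature.MathematicalPhysics.QuantumFieldTheory.Balaban1983to89.B8Ineq197

open B7Prop1Explicit B8ScaledSupNorm
open B8Ineq132 (BondTouches)

-- `Site` alone would resolve to the torus sites of `Setup.lean`; re-export the `ℤ^d` sites of `B7Prop1Explicit`.
export B7Prop1Explicit (Site)

variable {d : ℕ} {E : Type*} [SeminormedAddCommGroup E]

/-! ## §1 The star `st(x)` of a site (p. 77) -/

/-- «`b ∈ st(x)`» (p. 77: `st(x)` = the bonds with end-point `x`): the bond `⟨y, y + e_μ⟩` (encoded `(y, μ)` as in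
`B8Ineq132`/`B8ScaledSupNorm.bondNorm`) has `x` as one of its end-points. [cite: Balaban1985RegularSpaces, p.77 (convention before (1.5))] -/
def InStar (x y : Site d) (μ : Fin d) : Prop := y = x ∨ y + e μ = x

/-- p. 77: a bond of `st(x)` belongs to `Ω` (in the sense «at least one end-point of b belongs to Ω», `B8Ineq132.BondTouches`)
whenever `x ∈ Ω`. [cite: Balaban1985RegularSpaces, p.77 (convention before (1.5))] -/
theorem bondTouches_of_inStar {Ω : Set (Site d)} {x y : Site d} {μ : Fin d} (h : InStar x y μ) (hx : x ∈ Ω) :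
    BondTouches Ω y μ := by
  rcases h with rfl | rfl
  · exact Or.inl hx
  · exact Or.inr hx

/-! ## §2 (1.97) -/

/-- **(1.97), pointwise** (p. 92): *"Using the inequality (1.89) we can bound a value of this function at a point x ∈ Ω_j by
O(1) max_{b∈st(x)} |(Dλ)(b) − (DH′D′(u₁, λ))(b)| |A_b| < O(1)α₄(Lʲη)⁻¹B₁(α₀ + α₁)(Lʲη)⁻¹ = O(1)B₁(α₀ + α₁)α₄(Lʲη)⁻²"* — with
`X = Dλ − DH′D′(u₁, λ)` bounded as in (1.120) (`‖X_b‖ < a(Lʲη)⁻¹` for `b ∈ Ω_j`, `a = α₄`), `A` as in (1.69) (`‖A_b‖ < s(Lʲη)⁻¹`,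
`s = B₁(α₀ + α₁)`) and the `𝔉₃`-term `F` bounded by the (1.89) shape at some bond of `st(x)` (`C = O(1)`): `‖F(x)‖ ≤ C·a·s·(Lʲη)⁻²`
for `x ∈ Ω_j`. [cite: Balaban1985RegularSpaces, (1.97) p.92; (1.89) p.91; (1.120) p.96; (1.69) p.88] -/
theorem ineq197_pointwise {L k : ℕ} {η : ℝ} {Ω : ℕ → Set (Site d)} {X A : Site d → Fin d → E} {F : Site d → E}
    {C a s : ℝ} (hC : 0 ≤ C)
    (hF : ∀ x : Site d, ∃ (y : Site d) (μ : Fin d), InStar x y μ ∧ ‖F x‖ ≤ C * (‖X y μ‖ * ‖A y μ‖))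
    (hX : ∀ j, j ≤ k → ∀ (y : Site d) (μ : Fin d), BondTouches (Ω j) y μ → ‖X y μ‖ < a * ((L : ℝ) ^ j * η)⁻¹)
    (hA : ∀ j, j ≤ k → ∀ (y : Site d) (μ : Fin d), BondTouches (Ω j) y μ → ‖A y μ‖ < s * ((L : ℝ) ^ j * η)⁻¹)
    {j : ℕ} (hj : j ≤ k) {x : Site d} (hx : x ∈ Ω j) :
    ‖F x‖ ≤ C * (a * s) * (((L : ℝ) ^ j * η) ^ 2)⁻¹ := by
  obtain ⟨y, μ, hst, hFx⟩ := hF x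
  have hb : BondTouches (Ω j) y μ := bondTouches_of_inStar hst hx
  have h1 := hX j hj y μ hb
  have h2 := hA j hj y μ hb
  have hprod : ‖X y μ‖ * ‖A y μ‖ ≤ a * ((L : ℝ) ^ j * η)⁻¹ * (s * ((L : ℝ) ^ j * η)⁻¹) :=
    mul_le_mul h1.le h2.le (norm_nonneg _) ((norm_nonneg _).trans h1.le)
  calc ‖F x‖ ≤ C * (‖X y μ‖ * ‖A y μ‖) := hFx
    _ ≤ C * (a * ((L : ℝ) ^ j * η)⁻¹ * (s * ((L : ℝ) ^ j * η)⁻¹)) := mul_le_mul_of_nonneg_left hprod hC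
    _ = C * (a * s) * (((L : ℝ) ^ j * η) ^ 2)⁻¹ := by rw [← inv_pow]; ring

/-- **(1.97), norm form** (p. 92: *"Thus it is a function with a bounded norm |·|_(−2)"*): under the hypotheses of `ineq197_pointwise`
(`L ≥ 1`, `η > 0`, `a, s ≥ 0`), `|F|_(−2) ≤ C·a·s` for the p. 86 norm `B8ScaledSupNorm.siteNorm … (−2)` over `{Ω_j}_{j ≤ k}`.
[cite: Balaban1985RegularSpaces, (1.97) p.92; p.86 (definition after (1.55))] -/
theorem ineq197_norm {L k : ℕ} (hL : 1 ≤ L) {η : ℝ} (hη : 0 < η) {Ω : ℕ → Set (Site d)} {X A : Site d → Fin d → E}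
    {F : Site d → E} {C a s : ℝ} (hC : 0 ≤ C) (ha : 0 ≤ a) (hs : 0 ≤ s)
    (hF : ∀ x : Site d, ∃ (y : Site d) (μ : Fin d), InStar x y μ ∧ ‖F x‖ ≤ C * (‖X y μ‖ * ‖A y μ‖))
    (hX : ∀ j, j ≤ k → ∀ (y : Site d) (μ : Fin d), BondTouches (Ω j) y μ → ‖X y μ‖ < a * ((L : ℝ) ^ j * η)⁻¹)
    (hA : ∀ j, j ≤ k → ∀ (y : Site d) (μ : Fin d), BondTouches (Ω j) y μ → ‖A y μ‖ < s * ((L : ℝ) ^ j * η)⁻¹) :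
    siteNorm L k η (-(2 : ℝ)) Ω F ≤ C * (a * s) := by
  have h := siteNorm_le_of_pointwise (lam := F) hL hη 2 (by positivity)
    (fun j hj x hx => ineq197_pointwise hC hF hX hA hj hx)
  simpa using h

/-! ## §3 (1.98), the local half -/

/-- Pointwise domination passes to the p. 86 norms: if `‖G(x)‖ ≤ c‖F(x)‖` for all `x` (`c ≥ 0`) and the weighted family of `F` is
bounded (`B8ScaledSupNorm.Bdd`; automatic on finite lattices), then `|G|_(α) ≤ c|F|_(α)` for every exponent `α` and every domain
sequence — the mechanism of «V … bounded in this norm» (1.98). [cite: Balaban1985RegularSpaces, (1.98) p.92; p.86 (definition after (1.55))] -/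
theorem siteNorm_le_of_pointwise_dom {L k : ℕ} {η : ℝ} (hη : 0 ≤ η) {α : ℝ} {Ω : ℕ → Set (Site d)} {F G : Site d → E}
    {c : ℝ} (hc : 0 ≤ c) (hdom : ∀ x : Site d, ‖G x‖ ≤ c * ‖F x‖)
    (hB : Bdd L k η α (fun j (x : Site d) => x ∈ Ω j) F) :
    siteNorm L k η α Ω G ≤ c * siteNorm L k η α Ω F := by
  refine msup_le (mul_nonneg hc (msup_nonneg L k hη α _ F)) fun j hj x hx => ?_
  have hw : 0 ≤ weight L η α j := weight_nonneg L hη α j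
  calc weight L η α j * ‖G x‖ ≤ weight L η α j * (c * ‖F x‖) := mul_le_mul_of_nonneg_left (hdom x) hw
    _ = c * (weight L η α j * ‖F x‖) := by ring
    _ ≤ c * msup L k η α (fun j (x : Site d) => x ∈ Ω j) F :=
        mul_le_mul_of_nonneg_left (weight_mul_norm_le_msup hB hj hx) hc

/-- **(1.98), the `V`-half** (p. 92: *"It is a very simple local operator of the form (Vf)(x) = V(x)f(x), where V(x) is a linear
operator on the Lie algebra 𝔤, satisfying the bound |V| ≦ O(α₄). … |Vf|_(−2) ≦ O(α₄)|f|_(−2). (1.98)"*): for a family of continuous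
linear operators `V(x)` on `E` with `‖V(x)‖ ≤ c` and a bounded `f`, `|Vf|_(α) ≤ c|f|_(α)` for every exponent `α` (print: `α = −2`,
`c = O(α₄)`). [cite: Balaban1985RegularSpaces, (1.98) p.92] -/
theorem ineq198_local {E' : Type*} [NormedAddCommGroup E'] [NormedSpace ℝ E'] {L k : ℕ} {η : ℝ} (hη : 0 ≤ η) {α : ℝ}
    {Ω : ℕ → Set (Site d)} {V : Site d → (E' →L[ℝ] E')} {c : ℝ} (hc : 0 ≤ c) (hV : ∀ x : Site d, ‖V x‖ ≤ c)
    {f : Site d → E'} (hB : Bdd L k η α (fun j (x : Site d) => x ∈ Ω j) f) :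
    siteNorm L k η α Ω (fun x => V x (f x)) ≤ c * siteNorm L k η α Ω f :=
  siteNorm_le_of_pointwise_dom hη hc (fun x => ((V x).le_opNorm (f x)).trans
    (mul_le_mul_of_nonneg_right (hV x) (norm_nonneg _))) hB

end Literature.MathematicalPhysics.QuantumFieldTheory.Balaban1983to89.B8Ineq197
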